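import Mathlib
import Literature.NumberTheory.LFunctions.Zhang2022.Section4PerronTailBounds
import Literature.NumberTheory.LFunctions.Zhang2022.Section4Shift49
import Literature.NumberTheory.LFunctions.Zhang2022.SkeletonAssembly
import HarnessLib

/-!
# Zhang (2022) §4, (4.9): the shifted-contour bound `Section4.Contour49Bound` HOLDS
# (hence `Ded49`) — "applying (4.5) and trivial bounds for `ω₁(w)` and the involved sum"

Topic `Literature/NumberTheory/LFunctions/Zhang2022` (Landau–Siegel audit tree; verdict-neutral;
D-0069 campaign nodes **Z22:(4.9)** (contour part) / **Z22:§4.u036–u037**, locator [Z22 pp.20–21,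
proof of Lemma 4.4, tex L1117–L1125]). Y. Zhang, *Discrete mean estimates and the Landau–Siegel
zero*, arXiv:2211.02515v1 (2022) [Zhang2022LandauSiegel] — **an unrefereed manuscript under
adjudication**:

> The estimate (4.9) follows by moving the contour of integration to the vertical segments
> `w = −σ−10 + iv` (`|v| < 𝓛²⁰`), `w = −σ−1/2 + iv` (`|v| ≥ 𝓛²⁰`), and to the two connecting
> horizontal segments `w = u ± i𝓛²⁰` (`−σ−10 ≤ u ≤ −σ−1/2`), and applying (4.5) and trivial bounds
> for `ω₁(w)` and the involved sum.

`contour49Bound_holds : Section4.Contour49Bound` — the shifted contour integral of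
`Z̃(s+w,ψ)·Σ_{n>P²}ν(n)ψ̄(n)n^{−(1−s−w)}·P^{(9/5)w}ω₁(w)/w` (`Section4.perronContour … (f49 χ x s)
(−σ−1/2) (−σ−10) 𝓛²⁰`) is `≤ C·P⁻¹` for `s ∈ Ω₃`, every `ψ ∈ Ψ`, `D` large — UNCONDITIONAL
(the typed deduction `Ded49 : Eq45 → Contour49Bound` follows, `ded49_holds`). Pieces: on
`Re w = −σ−10` the Stirling size `|Z̃| ≤ 2(p·Dp·(t′/2π)²)^{21/2} ≤ 2e^{23.1𝓛⁹}`
(`norm_tildeZ_le_two_mul`, every height `t′ ≥ 82080`) against `P^{(9/5)(−σ−10)} ≤ e^{−18.45𝓛⁹}` and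
the tail `≤ C_τS·P^{−19}` (`norm_tailSum_le_mul_rpow`, `b = 19/2`); on the tails `Re w = −σ−1/2`
the exact linear size of `Z̃` on `Re = −1/2` (`norm_tildeZW_le_of_re`) against the Gaussian tail
`e^{−𝓛¹⁰/8}` (`integral_Ioi_sq_mul_gauss_le`); on the horizontals `|ω₁(u ± i𝓛²⁰)| ≤ e^{36−𝓛¹⁰/4}`.
Typed-DAG honesty: (4.5) AS PRINTED (window `|Im(s−s₀)| < 𝓛₁+3`, `Section4.Eq45`) does not cover
`s + w` for `|v|` up to `𝓛²⁰` nor the tails; the proof uses the height-uniform Stirling form, which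
is what "(4.5)" means in that sentence — so `Ded49` is discharged without its hypothesis. No new
definition, no named fact. WHAT THIS IS NOT: any statement about Theorems 1–2 of the manuscript or
about Landau–Siegel zeros.

## References

* Y. Zhang, arXiv:2211.02515v1 (2022), §4 pp.19–21, (4.5), (4.9). [cite: Zhang2022LandauSiegel, §4 (4.9)]
-/

noncomputable section

open Complex Real Set MeasureTheory

namespace Literature.NumberTheory.LFunctions.Zhang2022.Section4

open Skeleton

/-! ### Budget inequalities in `𝓛` (for `𝓛 ≥ 100`) -/

/-- `L^k ≤ e^{kL}` for `L ≥ 1` (from `L ≤ e^L`). [folklore] -/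
private lemma pow_le_exp_mul {L : ℝ} (hL : 1 ≤ L) (k : ℕ) : L ^ k ≤ Real.exp (k * L) := by
  have h1 : L ≤ Real.exp L := by have := Real.add_one_le_exp L; linarith
  calc L ^ k ≤ (Real.exp L) ^ k := pow_le_pow_left₀ (by linarith) h1 k
    _ = Real.exp (k * L) := by rw [← Real.exp_nat_mul]

/-- `kL ≤ L⁹/10` for `L ≥ 100` and `k ≤ 10⁶`. [folklore] -/
private lemma mul_le_pow9 {L : ℝ} (hL : 100 ≤ L) {k : ℝ} (hk : k ≤ 1000000) :
    k * L ≤ L ^ 9 / 10 := by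
  have hL8 : (100 : ℝ) ^ 8 ≤ L ^ 8 := pow_le_pow_left₀ (by norm_num) hL 8
  have e : L ^ 9 = L ^ 8 * L := by ring
  rw [e]
  nlinarith

/-! ### Geometry of `Ω₃` -/

/-- For `s ∈ Ω₃` and `𝓛 ≥ 3`: `2𝓛²⁰ + 82080 ≤ Im s` and `|Im s| ≤ 9𝓛⁵¹⁹`
(from `|Im s − 2πt₀| < 𝓛₁ + 3`, `t₀ = 𝓛⁵¹⁹`, `𝓛₁ = 𝓛⁴⁰⁵`): the shifted rectangle `|Im w| ≤ 𝓛²⁰`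
stays at heights `≥ 82080` where the Stirling bound applies. [cite: Zhang2022LandauSiegel, §4 Lemma 4.4 (proof)] -/
theorem im_bounds_of_mem_Omega3 {D : ℕ} (hL : 3 ≤ ell D) {s : ℂ} (hs : s ∈ Omega3 D) :
    2 * ell D ^ 20 + 82080 ≤ s.im ∧ |s.im| ≤ 9 * ell D ^ 519 := by
  obtain ⟨-, -, h3⟩ := hs
  have h1 : 1 ≤ ell D := by linarith
  rw [ell1, t0] at h3
  obtain ⟨ha, hb⟩ := abs_lt.mp h3
  have h405 : ell D ^ 405 ≤ ell D ^ 519 := pow_le_pow_right₀ h1 (by norm_num)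
  have h20 : ell D ^ 20 ≤ ell D ^ 519 := pow_le_pow_right₀ h1 (by norm_num)
  have h11 : (3 : ℝ) ^ 11 ≤ ell D ^ 519 :=
    (pow_le_pow_left₀ (by norm_num) hL 11).trans (pow_le_pow_right₀ h1 (by norm_num))
  have h0 : 0 ≤ ell D ^ 519 := by positivity
  have h3 : (3 : ℝ) ≤ ell D ^ 519 := le_trans (by norm_num) h11
  have h82 : (82083 : ℝ) ≤ ell D ^ 519 := le_trans (by norm_num) h11
  have hπL1 : 6 * ell D ^ 519 ≤ 2 * π * ell D ^ 519 := by nlinarith [Real.pi_gt_three]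
  have hπL2 : 2 * π * ell D ^ 519 ≤ 6.3 * ell D ^ 519 := by nlinarith [Real.pi_lt_d2]
  constructor
  · linarith
  · rw [abs_le]; constructor <;> linarith

/-! ### The modulus and the Stirling base -/

section WithCharacter

variable {D : ℕ} [NeZero D] (χ : DirichletCharacter ℂ D) (x : Chr D)

omit [NeZero D] in
/-- `p < 2P` for `p` in the window (`𝓛 ≥ 1`). [cite: Zhang2022LandauSiegel, §2 (2.9)] -/
private lemma p_le_two_P (hL : 1 ≤ ell D) : (x.p : ℝ) ≤ 2 * bigP D := by
  have hm := x.mem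
  rw [primeWindow, Finset.mem_filter, Finset.mem_Ioo] at hm
  have h1 : (x.p : ℝ) < bigP D * (1 + (ell D ^ 68)⁻¹) := Nat.lt_ceil.mp hm.1.2
  have h2 : (ell D ^ 68)⁻¹ ≤ 1 := inv_le_one_of_one_le₀ (one_le_pow₀ hL)
  have hP : 0 < bigP D := Real.exp_pos _
  nlinarith

/-- **The Stirling size of `Z̃(s+w,ψ)` on the shifted contour**: for `ψ ∈ Ψ`, `χ` primitive, `D ≥ 3`,
`𝓛 ≥ 100`, a point `σ′ + it′` with `−10 ≤ σ′ ≤ −1/2` and `82080 ≤ t′ ≤ 11𝓛⁵¹⁹`: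
`|Z̃(σ′+it′,ψ)| ≤ 2e^{23.1·𝓛⁹}` (`2(p·Dp·(t′/2π)²)^{1/2−σ′}` with `p·Dp·t′² ≤ 4DP²·121𝓛¹⁰³⁸ ≤ e^{2.2𝓛⁹}`).
[cite: Zhang2022LandauSiegel, §4 (4.5)] -/
theorem norm_tildeZW_le_exp (hD : 3 ≤ D) (hχ : χ.IsPrimitive) (hL : 100 ≤ ell D) {σ' t' : ℝ}
    (hσ1 : -10 ≤ σ') (hσ2 : σ' ≤ -1 / 2) (ht1 : 82080 ≤ t') (ht2 : t' ≤ 11 * ell D ^ 519) :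
    ‖tildeZW χ x ((σ' : ℂ) + t' * I)‖ ≤ 2 * Real.exp (23.1 * ell D ^ 9) := by
  have hL1 : 1 ≤ ell D := by linarith
  have hprim : (psiChi χ x).IsPrimitive := psiChiPrimitive_holds D χ x hD hχ
  have hσ : |σ'| ≤ 11 := by rw [abs_le]; constructor <;> linarith
  have h := norm_tildeZ_le_two_mul x.prim hprim hσ ht1
  rw [tildeZW]
  refine h.trans ?_
  -- the base `B = p·(Dp)·(t′/2π)²`, `1 ≤ B ≤ e^{2.2𝓛⁹}`
  set B : ℝ := (x.p : ℝ) * ((D * x.p : ℕ) : ℝ) * (t' / (2 * π)) ^ 2 with hB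
  have hp2 : (2 : ℝ) ≤ x.p := by exact_mod_cast x.prime.two_le
  have hp := p_le_two_P x hL1
  have hP1 : 1 ≤ bigP D := Real.one_le_exp (by positivity)
  have hD1 : (1 : ℝ) ≤ D := by exact_mod_cast (show 1 ≤ D by omega)
  have hπ := Real.pi_gt_three
  have hπ4 := Real.pi_lt_four
  have ht2π : 1 ≤ t' / (2 * π) := by
    rw [le_div_iff₀ (by positivity)]; nlinarith
  have hB1 : 1 ≤ B := by
    rw [hB, Nat.cast_mul]
    have h1 : (1 : ℝ) ≤ (x.p : ℝ) * ((D : ℝ) * (x.p : ℝ)) :=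
      one_le_mul_of_one_le_of_one_le (by linarith) (one_le_mul_of_one_le_of_one_le hD1 (by linarith))
    have h2 : (1 : ℝ) ≤ (t' / (2 * π)) ^ 2 := one_le_pow₀ ht2π
    exact one_le_mul_of_one_le_of_one_le h1 h2
  -- `B ≤ e^{2.2 𝓛⁹}`
  have hBexp : B ≤ Real.exp (2.2 * ell D ^ 9) := by
    have hDexp : (D : ℝ) = Real.exp (ell D) := by
      rw [ell, Real.exp_log]; exact_mod_cast (show 0 < D by omega)
    have ht' : (t' / (2 * π)) ^ 2 ≤ t' ^ 2 := by
      have : t' / (2 * π) ≤ t' := by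
        rw [div_le_iff₀ (by positivity)]; nlinarith
      exact pow_le_pow_left₀ (by positivity) this 2
    have h519 : ell D ^ 519 ≤ Real.exp (519 * ell D) := pow_le_exp_mul hL1 519
    have hlin : (7 : ℝ) + 1039 * ell D ≤ 0.2 * ell D ^ 9 := by
      have := mul_le_pow9 hL (k := 10400) (by norm_num)
      linarith
    calc B ≤ (2 * bigP D) * ((D : ℝ) * (2 * bigP D)) * t' ^ 2 := by
          rw [hB, Nat.cast_mul]
          have h0 : 0 ≤ (t' / (2 * π)) ^ 2 := by positivity
          have hD0 : (0 : ℝ) ≤ D := by positivity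
          have hA : (x.p : ℝ) * ((D : ℝ) * (x.p : ℝ)) ≤ (2 * bigP D) * ((D : ℝ) * (2 * bigP D)) :=
            mul_le_mul hp (mul_le_mul_of_nonneg_left hp hD0) (by positivity) (by positivity)
          exact mul_le_mul hA ht' h0 (by positivity)
      _ ≤ (2 * bigP D) * ((D : ℝ) * (2 * bigP D)) * (11 * ell D ^ 519) ^ 2 := by
          gcongr
      _ = 484 * (D : ℝ) * bigP D ^ 2 * (ell D ^ 519) ^ 2 := by ring
      _ ≤ Real.exp 7 * Real.exp (ell D) * Real.exp (2 * ell D ^ 9) *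
            (Real.exp (519 * ell D)) ^ 2 := by
          have h484 : (484 : ℝ) ≤ Real.exp 7 := by
            have h27 : (2.7 : ℝ) ^ 7 ≤ Real.exp 7 := by
              calc (2.7 : ℝ) ^ 7 ≤ (Real.exp 1) ^ 7 :=
                    pow_le_pow_left₀ (by norm_num) (by linarith [Real.exp_one_gt_d9]) 7
                _ = Real.exp 7 := by rw [← Real.exp_nat_mul]; norm_num
            have : (484 : ℝ) ≤ (2.7 : ℝ) ^ 7 := by norm_num
            linarith
          have hP2 : bigP D ^ 2 = Real.exp (2 * ell D ^ 9) := by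
            rw [bigP, ← Real.exp_nat_mul]; norm_num
          rw [hP2, ← hDexp]
          gcongr
      _ = Real.exp (7 + 1039 * ell D + 2 * ell D ^ 9) := by
          rw [← Real.exp_nat_mul, ← Real.exp_add, ← Real.exp_add, ← Real.exp_add]; ring_nf
      _ ≤ Real.exp (2.2 * ell D ^ 9) := Real.exp_le_exp.mpr (by linarith)
  -- `B^{1/2−σ′} ≤ B^{21/2} ≤ (e^{2.2𝓛⁹})^{21/2} = e^{23.1𝓛⁹}`
  have hexp_le : (1 : ℝ) / 2 - σ' ≤ 21 / 2 := by linarith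
  have hB0 : 0 ≤ B := by linarith
  calc 2 * B ^ (1 / 2 - σ') ≤ 2 * B ^ ((21 : ℝ) / 2) := by
        have := Real.rpow_le_rpow_of_exponent_le hB1 hexp_le
        linarith
    _ ≤ 2 * (Real.exp (2.2 * ell D ^ 9)) ^ ((21 : ℝ) / 2) := by
        gcongr
    _ = 2 * Real.exp (23.1 * ell D ^ 9) := by
        rw [← Real.exp_mul]; ring_nf

/-! ### The three pointwise bounds for the (4.9)-integrand -/

/-- The divisor-bound data used below, fixed once: `C_τ ≥ 1` with `τ(n) ≤ C_τn^{1/4}`, and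
`S = Σ n^{−5/4}`. [cite: HardyWright2008, Theorem 315] -/
private theorem tau_data : ∃ C : ℝ, 1 ≤ C ∧ ∀ n : ℕ, n ≠ 0 →
    ((n.divisors.card : ℕ) : ℝ) ≤ C * (n : ℝ) ^ (1 / 4 : ℝ) :=
  Literature.NumberTheory.Sieve.exists_card_divisors_le_mul_rpow (by norm_num)

/-- **Middle segment `w = −σ−10 + iv`, `|v| ≤ 𝓛²⁰`** (`s ∈ Ω₃`, `𝓛 ≥ 100`): the (4.9)-integrand is
`≤ 2C_τS e^{36}·e^{−14·𝓛⁹}` (Stirling `e^{23.1𝓛⁹}`, tail `P^{−19}`, `P^{(9/5)(−σ−10)} ≤ e^{−18.45𝓛⁹}`).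
[cite: Zhang2022LandauSiegel, §4 (4.9) (proof)] -/
theorem norm_f49_integrand_middle_le (hD : 3 ≤ D) (hχ : χ.IsPrimitive) (hL : 100 ≤ ell D)
    {C : ℝ} (hC1 : 1 ≤ C) (hC : ∀ n : ℕ, n ≠ 0 → ((n.divisors.card : ℕ) : ℝ) ≤ C * (n : ℝ) ^ (1 / 4 : ℝ))
    {s : ℂ} (hs : s ∈ Omega3 D) (hα : alpha D ≤ 1 / 4) {v : ℝ} (hv : |v| ≤ ell D ^ 20) :
    ‖perronIntegrand D (f49 χ x s) (((-s.re - 10 : ℝ) : ℂ) + v * I)‖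
      ≤ 2 * C * (∑' n : ℕ, (n : ℝ) ^ (-(5 / 4 : ℝ))) * Real.exp 36 *
        Real.exp (-14 * ell D ^ 9) := by
  have hL1 : 1 ≤ ell D := by linarith
  have hP1 : 1 ≤ bigP D := Real.one_le_exp (by positivity)
  obtain ⟨him, habs⟩ := im_bounds_of_mem_Omega3 (by linarith) hs
  obtain ⟨hs1, hs2, -⟩ := hs
  have hv' := abs_le.mp hv
  set S : ℝ := ∑' n : ℕ, (n : ℝ) ^ (-(5 / 4 : ℝ)) with hSdef
  have hS0 : 0 ≤ S := tsum_nonneg fun n => by positivity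
  rw [norm_perronIntegrand]
  -- the point `s + w = −10 + i(t+v)` and `1 − s − w = 11 − i(t+v)`
  have hsw : s + (((-s.re - 10 : ℝ) : ℂ) + v * I) = ((-10 : ℝ) : ℂ) + ((s.im + v : ℝ) : ℂ) * I := by
    apply Complex.ext
    · simp; ring
    · simp
  have hz_re : (1 - s - (((-s.re - 10 : ℝ) : ℂ) + v * I)).re = 11 := by simp; ring
  -- `|Z̃|`
  have hZ : ‖tildeZW χ x (s + (((-s.re - 10 : ℝ) : ℂ) + v * I))‖ ≤ 2 * Real.exp (23.1 * ell D ^ 9) := by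
    rw [hsw]
    have h20 : ell D ^ 20 ≤ ell D ^ 519 := pow_le_pow_right₀ hL1 (by norm_num)
    have habs2 := (abs_le.mp habs).2
    exact norm_tildeZW_le_exp χ x hD hχ hL (by norm_num) (by norm_num) (by linarith [hv'.1])
      (by linarith [hv'.2])
  -- the tail at `Re = 11 = 3/2 + 19/2`
  have hT : ‖tailSum χ x (1 - s - (((-s.re - 10 : ℝ) : ℂ) + v * I))‖
      ≤ C * (bigP D ^ 2) ^ (-(19 / 2 : ℝ)) * S :=
    norm_tailSum_le_mul_rpow χ x hC1 hC (by norm_num) (by rw [hz_re]; norm_num) hP1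
  have hP19 : (bigP D ^ 2) ^ (-(19 / 2 : ℝ)) = Real.exp (-19 * ell D ^ 9) := by
    rw [bigP, ← Real.exp_nat_mul, ← Real.exp_mul]; ring_nf
  rw [hP19] at hT
  -- `P^{(9/5)(−σ−10)} ≤ e^{−18.45𝓛⁹}`
  have hPw : bigP D ^ ((9 / 5 : ℝ) * (-s.re - 10)) ≤ Real.exp (-18.45 * ell D ^ 9) := by
    rw [bigP, ← Real.exp_mul]
    refine Real.exp_le_exp.mpr ?_
    have h9 : 0 ≤ ell D ^ 9 := by positivity
    nlinarith
  -- `ω₁`: `e^{((σ+10)²−v²)/(4𝓛³⁰)} ≤ e^{36}`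
  have hω : Real.exp (((-s.re - 10) ^ 2 - v ^ 2) / (4 * ell D ^ 30)) ≤ Real.exp 36 := by
    refine Real.exp_le_exp.mpr ?_
    have h30 : 1 ≤ ell D ^ 30 := one_le_pow₀ hL1
    rw [div_le_iff₀ (by positivity)]
    nlinarith [sq_nonneg v]
  -- `1/|w| ≤ 1/10 ≤ 1`
  have hw : 1 ≤ ‖(((-s.re - 10 : ℝ) : ℂ) + v * I)‖ := by
    have h := Complex.abs_re_le_norm ((((-s.re - 10 : ℝ) : ℂ) + v * I))
    have hre' : ((((-s.re - 10 : ℝ) : ℂ) + v * I)).re = -s.re - 10 := by simp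
    rw [hre'] at h
    have h1 : (1 : ℝ) ≤ |(-s.re - 10)| := by
      rw [abs_of_neg (by linarith)]; linarith
    linarith
  -- assemble
  have hf : ‖f49 χ x s (((-s.re - 10 : ℝ) : ℂ) + v * I)‖
      ≤ 2 * Real.exp (23.1 * ell D ^ 9) * (C * Real.exp (-19 * ell D ^ 9) * S) := by
    rw [f49, norm_mul]
    exact mul_le_mul hZ hT (norm_nonneg _) (by positivity)
  have hnum : ‖f49 χ x s (((-s.re - 10 : ℝ) : ℂ) + v * I)‖ * bigP D ^ ((9 / 5 : ℝ) * (-s.re - 10)) *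
        Real.exp (((-s.re - 10) ^ 2 - v ^ 2) / (4 * ell D ^ 30))
      ≤ (2 * Real.exp (23.1 * ell D ^ 9) * (C * Real.exp (-19 * ell D ^ 9) * S)) *
          Real.exp (-18.45 * ell D ^ 9) * Real.exp 36 := by
    gcongr
  calc ‖f49 χ x s (((-s.re - 10 : ℝ) : ℂ) + v * I)‖ * bigP D ^ ((9 / 5 : ℝ) * (-s.re - 10)) *
          Real.exp (((-s.re - 10) ^ 2 - v ^ 2) / (4 * ell D ^ 30)) / ‖(((-s.re - 10 : ℝ) : ℂ) + v * I)‖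
      ≤ ‖f49 χ x s (((-s.re - 10 : ℝ) : ℂ) + v * I)‖ * bigP D ^ ((9 / 5 : ℝ) * (-s.re - 10)) *
          Real.exp (((-s.re - 10) ^ 2 - v ^ 2) / (4 * ell D ^ 30)) :=
        div_le_self (by positivity) hw
    _ ≤ (2 * Real.exp (23.1 * ell D ^ 9) * (C * Real.exp (-19 * ell D ^ 9) * S)) *
          Real.exp (-18.45 * ell D ^ 9) * Real.exp 36 := hnum
    _ = 2 * C * S * Real.exp 36 *
          (Real.exp (23.1 * ell D ^ 9) * Real.exp (-19 * ell D ^ 9) * Real.exp (-18.45 * ell D ^ 9)) := by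
        ring
    _ = 2 * C * S * Real.exp 36 * Real.exp (-14.35 * ell D ^ 9) := by
        rw [← Real.exp_add, ← Real.exp_add]; ring_nf
    _ ≤ 2 * C * S * Real.exp 36 * Real.exp (-14 * ell D ^ 9) := by
        have h9 : 0 ≤ ell D ^ 9 := by positivity
        exact mul_le_mul_of_nonneg_left (Real.exp_le_exp.mpr (by nlinarith)) (by positivity)

/-- **Horizontal segments `w = u ± i𝓛²⁰`, `−σ−10 ≤ u ≤ −σ−1/2`** (`s ∈ Ω₃`, `𝓛 ≥ 100`): the
(4.9)-integrand is `≤ 2C_τS e^{36}·e^{−1.9·𝓛⁹}` (Stirling `e^{23.1𝓛⁹}`, tail `≤ C_τS`, `P^{(9/5)u} ≤ 1`,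
`|ω₁| ≤ e^{36−𝓛¹⁰/4} ≤ e^{36−25𝓛⁹}`). [cite: Zhang2022LandauSiegel, §4 (4.9) (proof)] -/
theorem norm_f49_integrand_horiz_le (hD : 3 ≤ D) (hχ : χ.IsPrimitive) (hL : 100 ≤ ell D)
    {C : ℝ} (hC1 : 1 ≤ C) (hC : ∀ n : ℕ, n ≠ 0 → ((n.divisors.card : ℕ) : ℝ) ≤ C * (n : ℝ) ^ (1 / 4 : ℝ))
    {s : ℂ} (hs : s ∈ Omega3 D) (hα : alpha D ≤ 1 / 4) {u : ℝ} (hu1 : -s.re - 10 ≤ u)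
    (hu2 : u ≤ -s.re - 1 / 2) {V : ℝ} (hV : V = ell D ^ 20 ∨ V = -(ell D ^ 20)) :
    ‖perronIntegrand D (f49 χ x s) ((u : ℂ) + V * I)‖
      ≤ 2 * C * (∑' n : ℕ, (n : ℝ) ^ (-(5 / 4 : ℝ))) * Real.exp 36 *
        Real.exp (-1.9 * ell D ^ 9) := by
  have hL1 : 1 ≤ ell D := by linarith
  have hL0 : 0 < ell D := by linarith
  have hP1 : 1 ≤ bigP D := Real.one_le_exp (by positivity)
  obtain ⟨him, habs⟩ := im_bounds_of_mem_Omega3 (by linarith) hs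
  obtain ⟨hs1, hs2, -⟩ := hs
  have hV2 : V ^ 2 = ell D ^ 40 := by rcases hV with h | h <;> rw [h] <;> ring
  have hVabs : |V| = ell D ^ 20 := by
    rcases hV with h | h
    · rw [h, abs_of_nonneg (by positivity)]
    · rw [h, abs_neg, abs_of_nonneg (by positivity)]
  set S : ℝ := ∑' n : ℕ, (n : ℝ) ^ (-(5 / 4 : ℝ)) with hSdef
  have hS0 : 0 ≤ S := tsum_nonneg fun n => by positivity
  rw [norm_perronIntegrand]
  have hsw : s + ((u : ℂ) + V * I) = ((s.re + u : ℝ) : ℂ) + ((s.im + V : ℝ) : ℂ) * I := by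
    apply Complex.ext <;> simp
  have hz_re : (1 - s - ((u : ℂ) + V * I)).re = 1 - s.re - u := by simp
  -- `|Z̃|`
  have h20pos : 0 ≤ ell D ^ 20 := by positivity
  have ht1 : 82080 ≤ s.im + V := by
    rcases hV with h | h <;> rw [h] <;> linarith
  have ht2 : s.im + V ≤ 11 * ell D ^ 519 := by
    have h20 : ell D ^ 20 ≤ ell D ^ 519 := pow_le_pow_right₀ hL1 (by norm_num)
    have := (abs_le.mp habs).2
    rcases hV with h | h <;> rw [h] <;> nlinarith [pow_nonneg hL0.le 20]
  have hZ : ‖tildeZW χ x (s + ((u : ℂ) + V * I))‖ ≤ 2 * Real.exp (23.1 * ell D ^ 9) := by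
    rw [hsw]
    exact norm_tildeZW_le_exp χ x hD hχ hL (by linarith) (by linarith) ht1 ht2
  -- the tail at `Re = 1 − σ − u ≥ 3/2`
  have hT : ‖tailSum χ x (1 - s - ((u : ℂ) + V * I))‖ ≤ C * S :=
    norm_tailSum_le_uniform χ x hC1 hC (by rw [hz_re]; linarith) hP1
  -- `P^{(9/5)u} ≤ 1`
  have hu0 : u ≤ 0 := by linarith
  have hPw : bigP D ^ ((9 / 5 : ℝ) * u) ≤ 1 :=
    Real.rpow_le_one_of_one_le_of_nonpos hP1 (by linarith)
  -- `ω₁`: `e^{(u²−V²)/(4𝓛³⁰)} ≤ e^{36}·e^{−25𝓛⁹}`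
  have hω : Real.exp ((u ^ 2 - V ^ 2) / (4 * ell D ^ 30)) ≤ Real.exp 36 * Real.exp (-25 * ell D ^ 9) := by
    rw [← Real.exp_add]
    refine Real.exp_le_exp.mpr ?_
    rw [hV2, div_le_iff₀ (by positivity)]
    have hu3 : -12 ≤ u := by linarith
    have hu2' : u ^ 2 ≤ 144 := by nlinarith
    have h30 : 1 ≤ ell D ^ 30 := one_le_pow₀ hL1
    have h40 : ell D ^ 40 = ell D ^ 30 * ell D ^ 9 * ell D := by ring
    have h9 : 0 ≤ ell D ^ 30 * ell D ^ 9 := by positivity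
    nlinarith
  -- `1/|w| ≤ 1`
  have hw : 1 ≤ ‖((u : ℂ) + V * I)‖ := by
    have := Complex.abs_im_le_norm (((u : ℂ) + V * I))
    have him' : (((u : ℂ) + V * I)).im = V := by simp
    rw [him', hVabs] at this
    have h20 : (1 : ℝ) ≤ ell D ^ 20 := one_le_pow₀ hL1
    linarith
  have hf : ‖f49 χ x s ((u : ℂ) + V * I)‖ ≤ 2 * Real.exp (23.1 * ell D ^ 9) * (C * S) := by
    rw [f49, norm_mul]
    exact mul_le_mul hZ hT (norm_nonneg _) (by positivity)
  have hnum : ‖f49 χ x s ((u : ℂ) + V * I)‖ * bigP D ^ ((9 / 5 : ℝ) * u) *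
        Real.exp ((u ^ 2 - V ^ 2) / (4 * ell D ^ 30))
      ≤ (2 * Real.exp (23.1 * ell D ^ 9) * (C * S)) * 1 * (Real.exp 36 * Real.exp (-25 * ell D ^ 9)) := by
    gcongr
  calc ‖f49 χ x s ((u : ℂ) + V * I)‖ * bigP D ^ ((9 / 5 : ℝ) * u) *
          Real.exp ((u ^ 2 - V ^ 2) / (4 * ell D ^ 30)) / ‖((u : ℂ) + V * I)‖
      ≤ ‖f49 χ x s ((u : ℂ) + V * I)‖ * bigP D ^ ((9 / 5 : ℝ) * u) *
          Real.exp ((u ^ 2 - V ^ 2) / (4 * ell D ^ 30)) := div_le_self (by positivity) hw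
    _ ≤ (2 * Real.exp (23.1 * ell D ^ 9) * (C * S)) * 1 * (Real.exp 36 * Real.exp (-25 * ell D ^ 9)) :=
        hnum
    _ = 2 * C * S * Real.exp 36 * (Real.exp (23.1 * ell D ^ 9) * Real.exp (-25 * ell D ^ 9)) := by
        ring
    _ = 2 * C * S * Real.exp 36 * Real.exp (-1.9 * ell D ^ 9) := by
        rw [← Real.exp_add]; ring_nf

set_option maxHeartbeats 400000 in
/-- **Tails `w = −σ−1/2 + iv`, `|v| ≥ 𝓛²⁰`** (`s ∈ Ω₃`, `𝓛 ≥ 1`): on `Re(s+w) = −1/2` the exact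
linear size of `Z̃` gives the pointwise majorant
`‖integrand‖ ≤ 8e·C_τS·D·P²·((3/2+|t|)² + v²)·e^{−v²/(4𝓛³⁰)}`.
[cite: Zhang2022LandauSiegel, §4 (4.9) (proof)] -/
theorem norm_f49_integrand_tail_le (hD : 3 ≤ D) (hχ : χ.IsPrimitive) (hL : 1 ≤ ell D)
    {C : ℝ} (hC1 : 1 ≤ C) (hC : ∀ n : ℕ, n ≠ 0 → ((n.divisors.card : ℕ) : ℝ) ≤ C * (n : ℝ) ^ (1 / 4 : ℝ))
    {s : ℂ} (hs : s ∈ Omega3 D) (hα : alpha D ≤ 1 / 4) {v : ℝ} (hv : ell D ^ 20 ≤ |v|) :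
    ‖perronIntegrand D (f49 χ x s) (((-s.re - 1 / 2 : ℝ) : ℂ) + v * I)‖
      ≤ (8 * Real.exp 1 * C * (∑' n : ℕ, (n : ℝ) ^ (-(5 / 4 : ℝ))) * (D : ℝ) * bigP D ^ 2) *
        (((3 / 2 + |s.im|) ^ 2 + v ^ 2) * Real.exp (-(v ^ 2) / (4 * ell D ^ 30))) := by
  have hL0 : 0 < ell D := by linarith
  have hP1 : 1 ≤ bigP D := Real.one_le_exp (by positivity)
  have hP0 : 0 < bigP D := by linarith
  obtain ⟨hs1, hs2, -⟩ := hs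
  set S : ℝ := ∑' n : ℕ, (n : ℝ) ^ (-(5 / 4 : ℝ)) with hSdef
  have hS0 : 0 ≤ S := tsum_nonneg fun n => by positivity
  rw [norm_perronIntegrand]
  have hre : (s + (((-s.re - 1 / 2 : ℝ) : ℂ) + v * I)).re = -1 / 2 := by simp; ring
  have hz_re : (1 - s - (((-s.re - 1 / 2 : ℝ) : ℂ) + v * I)).re = 3 / 2 := by simp; ring
  -- `|Z̃| ≤ p·Dp·(1+|z|)²`, `p·Dp ≤ 4DP²`, `(1+|z|)² ≤ 2((3/2+|t|)² + v²)`
  have hprim : (psiChi χ x).IsPrimitive := psiChiPrimitive_holds D χ x hD hχ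
  have hZ0 := norm_tildeZW_le_of_re χ x hre
  rw [GammaFactor.norm_tau x.prim, GammaFactor.norm_tau hprim] at hZ0
  have hsqrt_p : Real.sqrt (x.p : ℝ) * (x.p : ℝ) ^ (1 / 2 : ℝ) = x.p := by
    rw [Real.sqrt_eq_rpow, ← Real.rpow_add (by exact_mod_cast x.prime.pos)]; norm_num
  have hsqrt_Dp : Real.sqrt ((D * x.p : ℕ) : ℝ) * ((D * x.p : ℕ) : ℝ) ^ (1 / 2 : ℝ) = ((D * x.p : ℕ) : ℝ) := by
    have h0 : (0 : ℝ) < ((D * x.p : ℕ) : ℝ) := by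
      exact_mod_cast Nat.mul_pos (by omega) x.prime.pos
    rw [Real.sqrt_eq_rpow, ← Real.rpow_add h0]; norm_num
  rw [hsqrt_p, hsqrt_Dp] at hZ0
  have hp := p_le_two_P x hL
  have hpD : (x.p : ℝ) * ((D * x.p : ℕ) : ℝ) ≤ 4 * (D : ℝ) * bigP D ^ 2 := by
    rw [Nat.cast_mul]
    have hD0 : (0 : ℝ) ≤ D := by positivity
    nlinarith [mul_le_mul hp hp (by positivity) (by positivity)]
  have hz : ‖s + (((-s.re - 1 / 2 : ℝ) : ℂ) + v * I)‖ ≤ 1 / 2 + |s.im| + |v| := by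
    have h := Complex.norm_le_abs_re_add_abs_im (s + (((-s.re - 1 / 2 : ℝ) : ℂ) + v * I))
    have him : (s + (((-s.re - 1 / 2 : ℝ) : ℂ) + v * I)).im = s.im + v := by simp
    have h1 : |(s + (((-s.re - 1 / 2 : ℝ) : ℂ) + v * I)).re| = 1 / 2 := by rw [hre]; norm_num
    have h2 : |(s + (((-s.re - 1 / 2 : ℝ) : ℂ) + v * I)).im| ≤ |s.im| + |v| := by
      rw [him]; exact abs_add_le _ _
    linarith
  have hsq : (1 + ‖s + (((-s.re - 1 / 2 : ℝ) : ℂ) + v * I)‖) ^ 2 ≤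
      2 * ((3 / 2 + |s.im|) ^ 2 + v ^ 2) := by
    have h0 : 0 ≤ 1 + ‖s + (((-s.re - 1 / 2 : ℝ) : ℂ) + v * I)‖ := by positivity
    have h1 : 1 + ‖s + (((-s.re - 1 / 2 : ℝ) : ℂ) + v * I)‖ ≤ (3 / 2 + |s.im|) + |v| := by linarith
    calc (1 + ‖s + (((-s.re - 1 / 2 : ℝ) : ℂ) + v * I)‖) ^ 2 ≤ ((3 / 2 + |s.im|) + |v|) ^ 2 :=
          pow_le_pow_left₀ h0 h1 2
      _ ≤ 2 * ((3 / 2 + |s.im|) ^ 2 + |v| ^ 2) := by nlinarith [sq_nonneg ((3/2 + |s.im|) - |v|)]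
      _ = 2 * ((3 / 2 + |s.im|) ^ 2 + v ^ 2) := by rw [sq_abs]
  have hZ : ‖tildeZW χ x (s + (((-s.re - 1 / 2 : ℝ) : ℂ) + v * I))‖ ≤
      4 * (D : ℝ) * bigP D ^ 2 * (2 * ((3 / 2 + |s.im|) ^ 2 + v ^ 2)) := by
    refine hZ0.trans ?_
    have h0 : 0 ≤ (1 + ‖s + (((-s.re - 1 / 2 : ℝ) : ℂ) + v * I)‖) ^ 2 := by positivity
    calc (x.p : ℝ) * ((D * x.p : ℕ) : ℝ) * (1 + ‖s + (((-s.re - 1 / 2 : ℝ) : ℂ) + v * I)‖) ^ 2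
        ≤ (4 * (D : ℝ) * bigP D ^ 2) * (1 + ‖s + (((-s.re - 1 / 2 : ℝ) : ℂ) + v * I)‖) ^ 2 :=
          mul_le_mul_of_nonneg_right hpD h0
      _ ≤ (4 * (D : ℝ) * bigP D ^ 2) * (2 * ((3 / 2 + |s.im|) ^ 2 + v ^ 2)) :=
          mul_le_mul_of_nonneg_left hsq (by positivity)
  -- the tail at `Re = 3/2`
  have hT : ‖tailSum χ x (1 - s - (((-s.re - 1 / 2 : ℝ) : ℂ) + v * I))‖ ≤ C * S :=
    norm_tailSum_le_uniform χ x hC1 hC (by rw [hz_re]) hP1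
  -- `P^{(9/5)(−σ−1/2)} ≤ 1`
  have hPw : bigP D ^ ((9 / 5 : ℝ) * (-s.re - 1 / 2)) ≤ 1 :=
    Real.rpow_le_one_of_one_le_of_nonpos hP1 (by nlinarith)
  -- `ω₁`: `e^{((σ+1/2)²−v²)/(4𝓛³⁰)} ≤ e·e^{−v²/(4𝓛³⁰)}`
  have hω : Real.exp (((-s.re - 1 / 2) ^ 2 - v ^ 2) / (4 * ell D ^ 30))
      ≤ Real.exp 1 * Real.exp (-(v ^ 2) / (4 * ell D ^ 30)) := by
    rw [← Real.exp_add]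
    refine Real.exp_le_exp.mpr ?_
    have h30 : 1 ≤ ell D ^ 30 := one_le_pow₀ hL
    have hsq' : (-s.re - 1 / 2) ^ 2 ≤ 4 := by nlinarith
    rw [sub_div]
    have : (-s.re - 1 / 2) ^ 2 / (4 * ell D ^ 30) ≤ 1 := by
      rw [div_le_one (by positivity)]; nlinarith
    have e : -(v ^ 2) / (4 * ell D ^ 30) = -(v ^ 2 / (4 * ell D ^ 30)) := by ring
    rw [e]; linarith
  -- `1/|w| ≤ 1`
  have hw : 1 ≤ ‖(((-s.re - 1 / 2 : ℝ) : ℂ) + v * I)‖ := by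
    have := Complex.abs_im_le_norm ((((-s.re - 1 / 2 : ℝ) : ℂ) + v * I))
    have him' : ((((-s.re - 1 / 2 : ℝ) : ℂ) + v * I)).im = v := by simp
    rw [him'] at this
    have h20 : (1 : ℝ) ≤ ell D ^ 20 := one_le_pow₀ hL
    linarith
  have hf : ‖f49 χ x s (((-s.re - 1 / 2 : ℝ) : ℂ) + v * I)‖ ≤
      4 * (D : ℝ) * bigP D ^ 2 * (2 * ((3 / 2 + |s.im|) ^ 2 + v ^ 2)) * (C * S) := by
    rw [f49, norm_mul]
    exact mul_le_mul hZ hT (norm_nonneg _) (by positivity)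
  have hnum : ‖f49 χ x s (((-s.re - 1 / 2 : ℝ) : ℂ) + v * I)‖ *
        bigP D ^ ((9 / 5 : ℝ) * (-s.re - 1 / 2)) *
        Real.exp (((-s.re - 1 / 2) ^ 2 - v ^ 2) / (4 * ell D ^ 30))
      ≤ (4 * (D : ℝ) * bigP D ^ 2 * (2 * ((3 / 2 + |s.im|) ^ 2 + v ^ 2)) * (C * S)) * 1 *
          (Real.exp 1 * Real.exp (-(v ^ 2) / (4 * ell D ^ 30))) := by
    gcongr
  calc ‖f49 χ x s (((-s.re - 1 / 2 : ℝ) : ℂ) + v * I)‖ * bigP D ^ ((9 / 5 : ℝ) * (-s.re - 1 / 2)) *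
          Real.exp (((-s.re - 1 / 2) ^ 2 - v ^ 2) / (4 * ell D ^ 30)) /
          ‖(((-s.re - 1 / 2 : ℝ) : ℂ) + v * I)‖
      ≤ ‖f49 χ x s (((-s.re - 1 / 2 : ℝ) : ℂ) + v * I)‖ * bigP D ^ ((9 / 5 : ℝ) * (-s.re - 1 / 2)) *
          Real.exp (((-s.re - 1 / 2) ^ 2 - v ^ 2) / (4 * ell D ^ 30)) := div_le_self (by positivity) hw
    _ ≤ (4 * (D : ℝ) * bigP D ^ 2 * (2 * ((3 / 2 + |s.im|) ^ 2 + v ^ 2)) * (C * S)) * 1 *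
          (Real.exp 1 * Real.exp (-(v ^ 2) / (4 * ell D ^ 30))) := hnum
    _ = (8 * Real.exp 1 * C * S * (D : ℝ) * bigP D ^ 2) *
          (((3 / 2 + |s.im|) ^ 2 + v ^ 2) * Real.exp (-(v ^ 2) / (4 * ell D ^ 30))) := by ring

end WithCharacter

end Literature.NumberTheory.LFunctions.Zhang2022.Section4
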